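import Summits.HodgeConjecture.HodgeConjecture.Theorems.TropicalWeilObstructionTropicalHodgeBoundDiscreteStokes
import Summits.HodgeConjecture.HodgeConjecture.Theorems.TropicalWeilObstructionTropicalHodgeBoundFramePairing
import Literature.AlgebraicGeometry.Tropical.TorusCycles

/-!
# Crux `TropicalHodgeBound` (stmt-HodgeConjecture-18480), stub 4 — part R3: the cycle class of an
# effective tropical `4`-cycle has INTEGER coordinates in the period lattice

Route `TropicalWeilObstruction` of `HodgeConjecture`, registered line `birth`
(`Cruxes/TropicalHodgeBound/Lines/birth.lean`), stub `stub_rationalHodgeCoordinates`; ingredient (R)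
"rationality of `cyc`" (Mikhalkin–Zharkov Prop. 4.3: `[Z] ∈ ⋀⁴Γ₁ ⊗ ⋀⁴Γ₂`, `Γ₁ = Q·ℤᵍ` the period lattice,
`Γ₂ = ℤᵍ`), PROVED for every invertible period matrix `Q` and every `Z : TropicalTorusCycle g 4 Q`:

`cyc Z S S' = 576⁻¹ · Σ_{I : Fin 4 → Fin g} det Q[S, I] · y(I, S')` with INTEGERS `y(I, S') = intCoord Z I S'`
(`cyc_eq_sum_det_mul_intCoord`), `y` alternating in `I` and in `S'` and zero on non-injective words.

Proof. In period coordinates `u = Q⁻¹ v` the facets of the cells are `ℤᵍ`-translates of the reference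
facets (`facet_eq`), and by all-maps Cauchy–Binet (`sum_det_submatrix_mul_det_submatrix`, file
`…FramePairing`) `cyc Z S S' = 576⁻¹ Σ_I det Q[S,I] · Σ_σ w_σ Δ_{S'}(L_σ) h̃_{Φ_I}(u_σ)` with
`Φ_I = det of the rows I` (`rowForm`). The DISCRETE STOKES identity (file `…DiscreteStokes`) with
`rep = ` coordinatewise fractional part replaces every `u` by `⌊u⌋ ∈ ℤᵍ` without changing the sum, and
`h̃_{Φ_I}(⌊u_σ⌋)` is the determinant of an integer matrix.

No named fact, no sorry; the two definitions (`rowForm`, `intCoord`) are proof devices.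

References: [MikhalkinZharkov2014Eigenwave] G. Mikhalkin, I. Zharkov, Tropical eigenwave and intermediate
Jacobians, LN UMI 15 (2014), Def. 4.2, Prop. 4.3; [Zharkov2020TropicalWeil] I. Zharkov, arXiv:2002.02347,
p. 2.
-/

set_option linter.dupNamespace false

noncomputable section

namespace Summit.HodgeConjecture.HodgeConjecture.Theorems.TropicalHodgeBound

open scoped BigOperators
open Matrix Literature.AlgebraicGeometry.Tropical

section Rational

variable {g : ℕ}

/-- `Φ_I(x₀,…,x₃) = det (x_j (I a))_{j,a}`: the `4`-form "determinant of the rows `I`" on `ℝᵍ`, as an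
alternating map. [folklore] -/
def rowForm (I : Fin 4 → Fin g) : (Fin g → ℝ) [⋀^Fin 4]→ₗ[ℝ] ℝ :=
  Matrix.detRowAlternating.compLinearMap (LinearMap.funLeft ℝ ℝ I)

/-- `Φ_I` evaluated: the determinant of the matrix `(x_j (I a))_{j,a}`. [folklore] -/
theorem rowForm_apply (I : Fin 4 → Fin g) (x : Fin 4 → Fin g → ℝ) :
    rowForm I x = (Matrix.of fun (j : Fin 4) (a : Fin 4) => x j (I a)).det := rfl

/-- `h̃_{Φ_I}(u) = det ((u_{j+1} - u_0) (I a))_{j,a}`. [folklore] -/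
theorem simplexForm_rowForm (I : Fin 4 → Fin g) (u : Fin 5 → Fin g → ℝ) :
    simplexForm (rowForm I) u = (Matrix.of fun (j : Fin 4) (a : Fin 4) => u j.succ (I a) - u 0 (I a)).det := by
  rw [simplexForm, rowForm_apply]
  rfl

/-- The INTEGER coordinates of the cycle class: `y(I,S') = Σ_σ w_σ · Δ_{S'}(L_σ) · det M_{σ,I}` with
`M_{σ,I}` the integer matrix `(⌊u_{σ,j+1}(I a)⌋ - ⌊u_{σ,0}(I a)⌋)_{j,a}`, `u = Q⁻¹ v` the vertices in
period coordinates. [cite: MikhalkinZharkov2014Eigenwave, Prop. 4.3] -/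
def intCoord {Q : Matrix (Fin g) (Fin g) ℝ} (Z : TropicalTorusCycle g 4 Q) (I S' : Fin 4 → Fin g) : ℤ :=
  ∑ σ, ((Z.cell σ).weight : ℤ) * pluckerCoord (Z.cell σ).frame S' *
    (Matrix.of fun (j : Fin 4) (a : Fin 4) => ⌊(Q⁻¹ *ᵥ (Z.cell σ).vertex j.succ) (I a)⌋ -
      ⌊(Q⁻¹ *ᵥ (Z.cell σ).vertex 0) (I a)⌋).det

/-- `y` is alternating in the first word. [folklore] -/
theorem intCoord_comp_perm_left {Q : Matrix (Fin g) (Fin g) ℝ} (Z : TropicalTorusCycle g 4 Q)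
    (I S' : Fin 4 → Fin g) (τ : Equiv.Perm (Fin 4)) :
    intCoord Z (I ∘ τ) S' = ((Equiv.Perm.sign τ : ℤˣ) : ℤ) * intCoord Z I S' := by
  unfold intCoord
  rw [Finset.mul_sum]
  refine Finset.sum_congr rfl fun σ _ => ?_
  have h : (Matrix.of fun (j : Fin 4) (a : Fin 4) => ⌊(Q⁻¹ *ᵥ (Z.cell σ).vertex j.succ) ((I ∘ τ) a)⌋ -
        ⌊(Q⁻¹ *ᵥ (Z.cell σ).vertex 0) ((I ∘ τ) a)⌋) =
      (Matrix.of fun (j : Fin 4) (a : Fin 4) => ⌊(Q⁻¹ *ᵥ (Z.cell σ).vertex j.succ) (I a)⌋ -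
        ⌊(Q⁻¹ *ᵥ (Z.cell σ).vertex 0) (I a)⌋).submatrix id τ := by
    ext j a; rfl
  rw [h, Matrix.det_permute']
  simp only [Int.cast_id]
  ring

/-- `y` is alternating in the second word. [folklore] -/
theorem intCoord_comp_perm_right {Q : Matrix (Fin g) (Fin g) ℝ} (Z : TropicalTorusCycle g 4 Q)
    (I S' : Fin 4 → Fin g) (τ : Equiv.Perm (Fin 4)) :
    intCoord Z I (S' ∘ τ) = ((Equiv.Perm.sign τ : ℤˣ) : ℤ) * intCoord Z I S' := by
  unfold intCoord
  rw [Finset.mul_sum]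
  refine Finset.sum_congr rfl fun σ _ => ?_
  have h : pluckerCoord (Z.cell σ).frame (S' ∘ τ) =
      ((Equiv.Perm.sign τ : ℤˣ) : ℤ) * pluckerCoord (Z.cell σ).frame S' := by
    unfold pluckerCoord
    rw [show (Z.cell σ).frame.submatrix (S' ∘ ⇑τ) id = ((Z.cell σ).frame.submatrix S' id).submatrix τ id
      from rfl, Matrix.det_permute]
    simp only [Int.cast_id]
  rw [h]; ring

/-- `y` vanishes on non-injective first words. [folklore] -/
theorem intCoord_eq_zero_left {Q : Matrix (Fin g) (Fin g) ℝ} (Z : TropicalTorusCycle g 4 Q)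
    (I S' : Fin 4 → Fin g) (hI : ¬ Function.Injective I) : intCoord Z I S' = 0 := by
  unfold intCoord
  refine Finset.sum_eq_zero fun σ _ => ?_
  obtain ⟨a, b, hab, hne⟩ : ∃ a b, I a = I b ∧ a ≠ b := by
    simpa [Function.Injective] using hI
  rw [← Matrix.det_transpose, Matrix.det_zero_of_row_eq hne]
  · ring
  · funext j; simp [hab]

/-- `y` vanishes on non-injective second words. [folklore] -/
theorem intCoord_eq_zero_right {Q : Matrix (Fin g) (Fin g) ℝ} (Z : TropicalTorusCycle g 4 Q)
    (I S' : Fin 4 → Fin g) (hS : ¬ Function.Injective S') : intCoord Z I S' = 0 := by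
  unfold intCoord
  refine Finset.sum_eq_zero fun σ _ => ?_
  obtain ⟨a, b, hab, hne⟩ : ∃ a b, S' a = S' b ∧ a ≠ b := by
    simpa [Function.Injective] using hS
  have h : pluckerCoord (Z.cell σ).frame S' = 0 := by
    unfold pluckerCoord
    exact Matrix.det_zero_of_row_eq hne (by funext j; simp [hab])
  rw [h]; ring

variable {Q : Matrix (Fin g) (Fin g) ℝ}

/-- The real edge matrix of a cell: `E = L · T`, columns `v_{j+1} - v_0`. [folklore] -/
theorem frame_mul_edgeCoeff_apply (c : TropicalCell g 4) (a : Fin g) (j : Fin 4) :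
    (c.frame.map (Int.cast : ℤ → ℝ) * c.edgeCoeff) a j = c.vertex j.succ a - c.vertex 0 a := by
  rw [c.vertex_succ_sub j a, Matrix.mul_apply]
  rfl

/-- **The cycle class through the period coordinates.** For invertible `Q`:
`cyc Z S S' = 576⁻¹ Σ_I det Q[S,I] · Σ_σ w_σ Δ_{S'}(L_σ) · h̃_{Φ_I}(Q⁻¹ v_σ)`.
[cite: MikhalkinZharkov2014Eigenwave, Prop. 4.3] -/
theorem cyc_eq_sum_det_mul_simplexForm (hQ : IsUnit Q.det) (Z : TropicalTorusCycle g 4 Q)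
    (S S' : Fin 4 → Fin g) :
    Z.cyc S S' = (1 / 576 : ℝ) * ∑ I : Fin 4 → Fin g, (Q.submatrix S I).det *
      ∑ σ, ((Z.cell σ).weight : ℝ) * (pluckerCoord (Z.cell σ).frame S' : ℝ) *
        simplexForm (rowForm I) (fun k => Q⁻¹ *ᵥ (Z.cell σ).vertex k) := by
  classical
  -- per cell: `24 · a_σ · Δ_S(L_σ) = det E_σ[S] = (1/24) Σ_I det Q[S,I] · h̃_{Φ_I}(u_σ)`
  have hcell : ∀ σ, ((Z.cell σ).weight : ℝ) * (Z.cell σ).latticeVolume *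
      (pluckerCoord (Z.cell σ).frame S : ℝ) * (pluckerCoord (Z.cell σ).frame S' : ℝ) =
      (1 / 576 : ℝ) * ∑ I : Fin 4 → Fin g, (Q.submatrix S I).det *
        (((Z.cell σ).weight : ℝ) * (pluckerCoord (Z.cell σ).frame S' : ℝ) *
          simplexForm (rowForm I) (fun k => Q⁻¹ *ᵥ (Z.cell σ).vertex k)) := by
    intro σ
    -- `det E[S] = Δ_S(L) · det T` for the real edge matrix `E = L · T`
    have hES : (((Z.cell σ).frame.map (Int.cast : ℤ → ℝ) * (Z.cell σ).edgeCoeff).submatrix S id).det =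
        (pluckerCoord (Z.cell σ).frame S : ℝ) * (Z.cell σ).edgeCoeff.det := by
      have : ((Z.cell σ).frame.map (Int.cast : ℤ → ℝ) * (Z.cell σ).edgeCoeff).submatrix S id =
          ((Z.cell σ).frame.map (Int.cast : ℤ → ℝ)).submatrix S id * (Z.cell σ).edgeCoeff := by
        ext a j; simp [Matrix.mul_apply]
      rw [this, Matrix.det_mul, pluckerCoord, Int.cast_det]
      rfl
    -- `E = Q (Q⁻¹ E)` and Cauchy–Binet
    have hQE : ((Z.cell σ).frame.map (Int.cast : ℤ → ℝ) * (Z.cell σ).edgeCoeff).submatrix S id =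
        Q.submatrix S id * (Q⁻¹ * ((Z.cell σ).frame.map (Int.cast : ℤ → ℝ) * (Z.cell σ).edgeCoeff)) := by
      have h1 : Q * (Q⁻¹ * ((Z.cell σ).frame.map (Int.cast : ℤ → ℝ) * (Z.cell σ).edgeCoeff)) =
          (Z.cell σ).frame.map (Int.cast : ℤ → ℝ) * (Z.cell σ).edgeCoeff := by
        rw [← Matrix.mul_assoc, Matrix.mul_nonsing_inv Q hQ, Matrix.one_mul]
      conv_lhs => rw [← h1]
      ext a j; simp [Matrix.mul_apply]
    have hCB := sum_det_submatrix_mul_det_submatrix (Q.submatrix S id)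
      (Q⁻¹ * ((Z.cell σ).frame.map (Int.cast : ℤ → ℝ) * (Z.cell σ).edgeCoeff))
    have h24 : ((4 : ℕ).factorial : ℝ) = 24 := by norm_num [Nat.factorial]
    -- `det (Q⁻¹E)[I] = h̃_{Φ_I}(u)`
    have hI : ∀ I : Fin 4 → Fin g,
        ((Q⁻¹ * ((Z.cell σ).frame.map (Int.cast : ℤ → ℝ) * (Z.cell σ).edgeCoeff)).submatrix I id).det =
        simplexForm (rowForm I) (fun k => Q⁻¹ *ᵥ (Z.cell σ).vertex k) := by
      intro I
      rw [simplexForm_rowForm, ← Matrix.det_transpose]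
      congr 1
      ext j a
      simp only [Matrix.transpose_apply, Matrix.submatrix_apply, id, Matrix.of_apply,
        Matrix.mulVec, dotProduct, ← Finset.sum_sub_distrib, ← mul_sub]
      rw [Matrix.mul_apply]
      refine Finset.sum_congr rfl fun b _ => ?_
      rw [frame_mul_edgeCoeff_apply]
    have hsub : ∀ I : Fin 4 → Fin g, (Q.submatrix S id).submatrix id I = Q.submatrix S I := fun I => rfl
    -- assemble
    have hvol : ((Z.cell σ).weight : ℝ) * (Z.cell σ).latticeVolume * (pluckerCoord (Z.cell σ).frame S : ℝ) *
        (pluckerCoord (Z.cell σ).frame S' : ℝ) =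
        (1 / 24 : ℝ) * (((Z.cell σ).weight : ℝ) * (pluckerCoord (Z.cell σ).frame S' : ℝ)) *
          (((Z.cell σ).frame.map (Int.cast : ℤ → ℝ) * (Z.cell σ).edgeCoeff).submatrix S id).det := by
      rw [hES, TropicalCell.latticeVolume, h24]; ring
    rw [hvol, hQE, show (Q.submatrix S id *
        (Q⁻¹ * ((Z.cell σ).frame.map (Int.cast : ℤ → ℝ) * (Z.cell σ).edgeCoeff))).det =
      (1 / 24 : ℝ) * ∑ f : Fin 4 → Fin g, ((Q.submatrix S id).submatrix id f).det *
        ((Q⁻¹ * ((Z.cell σ).frame.map (Int.cast : ℤ → ℝ) * (Z.cell σ).edgeCoeff)).submatrix f id).det by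
      rw [hCB, h24]; ring]
    rw [Finset.mul_sum, Finset.mul_sum, Finset.mul_sum]
    refine Finset.sum_congr rfl fun I _ => ?_
    rw [hsub, hI]
    ring
  unfold TropicalTorusCycle.cyc
  simp_rw [hcell]
  rw [← Finset.mul_sum, Finset.sum_comm]
  congr 1
  refine Finset.sum_congr rfl fun I _ => ?_
  rw [Finset.mul_sum]

/-- **Integrality of the cycle class in period coordinates** (`[Z] ∈ ⋀⁴(Qℤᵍ) ⊗ ⋀⁴ℤᵍ`): for invertible
`Q`, `cyc Z S S' = 576⁻¹ · Σ_{I} det Q[S, I] · intCoord Z I S'` with `intCoord Z I S' ∈ ℤ`.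
[cite: MikhalkinZharkov2014Eigenwave, Prop. 4.3] -/
theorem cyc_eq_sum_det_mul_intCoord (hQ : IsUnit Q.det) (Z : TropicalTorusCycle g 4 Q)
    (S S' : Fin 4 → Fin g) :
    Z.cyc S S' = (1 / 576 : ℝ) * ∑ I : Fin 4 → Fin g, (Q.submatrix S I).det * (intCoord Z I S' : ℝ) := by
  classical
  rw [cyc_eq_sum_det_mul_simplexForm hQ Z S S']
  congr 1
  refine Finset.sum_congr rfl fun I _ => ?_
  congr 1
  -- discrete Stokes with `rep` = coordinatewise fractional part
  let rep : (Fin g → ℝ) → (Fin g → ℝ) := fun v r => Int.fract (v r)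
  have hStokes := sum_simplexForm_eq_sum_simplexForm_sub_rep (rowForm I) rep
    (fun σ k => Q⁻¹ *ᵥ (Z.cell σ).vertex k)
    (fun σ => ((Z.cell σ).weight : ℤ) * pluckerCoord (Z.cell σ).frame S')
    Z.facetClass Z.facetPerm (fun σ i r => (Z.facetShift σ i r : ℝ))
    (fun f j => Q⁻¹ *ᵥ Z.refFacet f j) ?_ ?_ ?_
  · rw [show ∑ σ, ((Z.cell σ).weight : ℝ) * (pluckerCoord (Z.cell σ).frame S' : ℝ) *
        simplexForm (rowForm I) (fun k => Q⁻¹ *ᵥ (Z.cell σ).vertex k) =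
        ∑ σ, ((((Z.cell σ).weight : ℤ) * pluckerCoord (Z.cell σ).frame S' : ℤ) : ℝ) *
          simplexForm (rowForm I) (fun k => Q⁻¹ *ᵥ (Z.cell σ).vertex k) from
        Finset.sum_congr rfl fun σ _ => by push_cast; ring, hStokes, intCoord]
    push_cast
    refine Finset.sum_congr rfl fun σ _ => ?_
    congr 1
    rw [simplexForm_rowForm]
    congr 1
    ext j a
    simp only [Matrix.of_apply, Matrix.map_apply, Int.cast_sub, rep, Pi.sub_apply, Int.self_sub_fract]
  · -- facets in period coordinates are integer translates of the reference facets
    intro σ i j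
    have hv : (Z.cell σ).vertex (i.succAbove (Z.facetPerm σ i j)) =
        Z.refFacet (Z.facetClass σ i) j + Q *ᵥ fun b => (Z.facetShift σ i b : ℝ) := by
      funext a
      rw [Z.facet_eq σ i j a]
      rfl
    simp only [hv, Matrix.mulVec_add, Matrix.mulVec_mulVec, Matrix.nonsing_inv_mul Q hQ,
      Matrix.one_mulVec]
  · -- `rep` is invariant under integer shifts
    intro σ i v
    funext r
    simp only [rep, Pi.add_apply, Int.fract_add_intCast]
  · -- balancing
    intro f
    have hb := Z.balanced f S'
    calc (∑ σ, ∑ i : Fin 5, if Z.facetClass σ i = f then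
          ((((Z.cell σ).weight : ℤ) * pluckerCoord (Z.cell σ).frame S' : ℤ) : ℝ) * (-1 : ℝ) ^ (i : ℕ) *
            (((Equiv.Perm.sign (Z.facetPerm σ i) : ℤˣ) : ℤ) : ℝ) else 0)
        = ((∑ σ, ∑ i : Fin 5, (if Z.facetClass σ i = f then
            ((Z.cell σ).weight : ℤ) * (-1) ^ (i : ℕ) * ((Equiv.Perm.sign (Z.facetPerm σ i) : ℤˣ) : ℤ) *
              pluckerCoord (Z.cell σ).frame S' else 0) : ℤ) : ℝ) := by
          push_cast
          refine Finset.sum_congr rfl fun σ _ => Finset.sum_congr rfl fun i _ => ?_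
          split_ifs <;> ring
      _ = 0 := by rw [hb]; simp

end Rational

end Summit.HodgeConjecture.HodgeConjecture.Theorems.TropicalHodgeBound

end
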